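import Summits.QuantumFields.YangMills.Theorems.ScalingWindowSplitCurvatureAmnesiaWilsonSchwingerDyson
import Summits.QuantumFields.YangMills.Theorems.BalabanLadderNTMirrorSplitTorus
import Mathlib.Algebra.QuadraticDiscriminant
import HarnessLib

/-!
# Crux `NT` / seam `UVSeamRec.stub_floorsEngine` (S-B), residual MF: the CRAMÉR–RAO / STEIN (FISHER) FLOOR for a
# variance, and the mirror floor of a Θ-INVARIANT localiser (card `fisher-score-floor`, kernel-checked in the tree)

Helper file (`--supports stmt-QuantumFields-20043`; owner RULINGS R78/R87) of the fleet lead `ym-spine-19353-p1`,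
kernel-checking in the tree crux-ideate card `fisher-score-floor` (seat `ym-cruxidea-19353-2` g8, HOME sketch
`FisherFloor.lean`, rc 0) and composing it with the RP-localiser currency `…NTMirrorSplitTorus` (p543194).
WHICH CLAUSE IT SUPPLIES: the R87 residual MF(4ε) of conjunct 2 (two-point floor) of the REGISTERED
`UVSeamRec.stub_floorsEngine`, through (LMF) of `MirrorSplitFloors.stubFloorsEngine_of_localisedMirror_rF` (p544360)
for a Θ′-INVARIANT localiser `h` (a functional of time-0 SPATIAL links): then `Cov_T(h∘Θ′, h) = Var_T(h)`
(`torus_mirror_floor_of_invariant_localiser`: MF ≥ Var_T(h) − 2|Cov_T(h, W∘lift − h)|), and a VARIANCE has the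
Cramér–Rao / Stein floor of §2 — a floor whose numerator is a ONE-POINT expectation.

* §1 `sq_integral_mul_le`, `sq_integral_mul_le_var` — Cauchy–Schwarz in covariance form for continuous observables of
  Wilson's torus measure (discriminant argument).
* §2 `stein_identity`, `stein_mean_zero`, **`fisher_floor`** — for ANY finite family of one-link directions `(eᵢ, kᵢ)`
  and continuous `V = (Vᵢ)` with shift-derivatives `V'ᵢ`, the STEIN OPERATOR `𝒪_V := Σᵢ (∂ᵢVᵢ − β·Vᵢ·∂ᵢS)` satisfies
  `E[f·𝒪_V] = −Σᵢ E[Vᵢ·∂ᵢf]`, `E[𝒪_V] = 0` (tree one-link Schwinger–Dyson `integral_shiftDeriv_eq_wilson`, summed),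
  hence `(Σᵢ E[Vᵢ ∂ᵢf])² ≤ Var(f) · E[𝒪_V²]`.
* §3 `apply_cfgReflect_of_timeZero`, `mirrorCov_eq_var_of_invariant` — a cylinder functional of time-0 spatial links is
  `Θ₀`-invariant; for a `Θ₀`-invariant functional the mirror covariance IS the torus variance.
* §4 `fisher_floor_lift`; `sf_of_gradOverlapFloor_of_scoreCeiling` — a mirror floor `4ε ≤ Cov_T(𝒢∘Θ₀, 𝒢)` for a
  Θ-invariant family from a GRADIENT-OVERLAP FLOOR `φ ≤ |Σᵢ E_T[Vᵢ ∂ᵢ𝒢]|` and a SCORE CEILING `E_T[𝒪_V²] ≤ M`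
  (`ε = φ²/(4M)`) — the (SF)/(LMF) slot of the Markov–mirror press-buttons for a PINNED Θ-invariant functional.
* §5 `torus_mirror_floor_of_invariant_localiser` — the composition with `MirrorSplit.torus_mirror_floor_of_posHalf`.

HONEST FRAMING.  Integration by parts + Cauchy–Schwarz; the gradient-overlap floor and the score ceiling for a pinned
functional are engine-grade OPEN one-point statements; nothing about NT, the seam or a gap.
[cite: OsterwalderSeiler1978, §2; GlimmJaffe1987, §6.1]
-/

set_option autoImplicit false


noncomputable section

open MeasureTheory Filter Topology
open Literature.MathematicalPhysics.QuantumFieldTheory Literature.MathematicalPhysics.QuantumLattice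
open Summit.QuantumFields.YangMills.Cruxes.CurvatureAmnesia.WardDefect.SchwingerDyson
  (integral_shiftDeriv_eq_wilson oneParam_zero)
open Summit.QuantumFields.YangMills.Theorems.EquipartitionPinsProbe.TangentSteinFiniteBeta (exists_abs_le_of_continuous)
open Summit.QuantumFields.YangMills.Cruxes.OSLegsFromFemtoAndGap.DlrCollarTransfer (torusE)

namespace Summit.QuantumFields.YangMills.Cruxes.NT.FisherFloor

/-! ## §1 Cauchy–Schwarz in covariance form on the torus -/

section Torus

variable {G : Type} [Group G] [TopologicalSpace G] [IsTopologicalGroup G] [CompactSpace G]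
  [MeasurableSpace G] [BorelSpace G] (r : LatticeRep G) {d M : ℕ} [NeZero M]

/-- Continuous real observables on the compact configuration space are integrable for Wilson's measure. [folklore] -/
theorem integrable_of_continuous (β : ℝ) {F : GaugeConfig d M G → ℝ} (hF : Continuous F) :
    Integrable F (wilsonMeasure (d := d) (L := M) r.ρ β) := by
  haveI : SecondCountableTopology G :=
    (r.continuous.isClosedEmbedding r.injective).isEmbedding.secondCountableTopology
  haveI := isProbabilityMeasure_wilsonMeasure (d := d) (L := M) r.ρ r.continuous β
  obtain ⟨C, -, hC⟩ := exists_abs_le_of_continuous hF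
  exact Integrable.of_bound hF.measurable.aestronglyMeasurable C
    (ae_of_all _ fun U => by simpa [Real.norm_eq_abs] using hC U)

/-- **Cauchy–Schwarz** for continuous observables of Wilson's torus measure:
`(∫ u g)² ≤ ∫ u² · ∫ g²` (discriminant of `t ↦ ∫ (t u + g)² ≥ 0`). [folklore] -/
theorem sq_integral_mul_le (β : ℝ) (u g : GaugeConfig d M G → ℝ) (hu : Continuous u) (hg : Continuous g) :
    (∫ U, u U * g U ∂(wilsonMeasure (d := d) (L := M) r.ρ β)) ^ 2 ≤
      (∫ U, u U ^ 2 ∂(wilsonMeasure (d := d) (L := M) r.ρ β)) *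
        (∫ U, g U ^ 2 ∂(wilsonMeasure (d := d) (L := M) r.ρ β)) := by
  set μ := wilsonMeasure (d := d) (L := M) r.ρ β with hμ
  set A := ∫ U, u U ^ 2 ∂μ with hA
  set B := ∫ U, u U * g U ∂μ with hB
  set C := ∫ U, g U ^ 2 ∂μ with hC
  have key : ∀ t : ℝ, 0 ≤ A * (t * t) + 2 * B * t + C := by
    intro t
    have h1 : 0 ≤ ∫ U, (t * u U + g U) ^ 2 ∂μ := integral_nonneg fun U => sq_nonneg _
    have i1 : Integrable (fun U => t ^ 2 * u U ^ 2) μ :=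
      integrable_of_continuous r β (continuous_const.mul (hu.pow 2))
    have i2 : Integrable (fun U => 2 * t * (u U * g U)) μ :=
      integrable_of_continuous r β (continuous_const.mul (hu.mul hg))
    have i3 : Integrable (fun U => g U ^ 2) μ := integrable_of_continuous r β (hg.pow 2)
    have h2 : ∫ U, (t * u U + g U) ^ 2 ∂μ = A * (t * t) + 2 * B * t + C := by
      have hsplit : (fun U => (t * u U + g U) ^ 2) =
          fun U => t ^ 2 * u U ^ 2 + 2 * t * (u U * g U) + g U ^ 2 := by
        funext U; ring
      have i12 : Integrable (fun U => t ^ 2 * u U ^ 2 + 2 * t * (u U * g U)) μ := i1.add i2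
      rw [hsplit, integral_add i12 i3, integral_add i1 i2, integral_const_mul, integral_const_mul]
      ring
    linarith
  have key' : ∀ t : ℝ, 0 ≤ A * (t * t) + 2 * B * t + C := key
  have hd : discrim A (2 * B) C ≤ 0 := discrim_le_zero fun t => by
    have := key' t
    nlinarith [this]
  unfold discrim at hd
  nlinarith [hd]

/-- **Covariance form**: if `∫ g = 0` then `(∫ f g)² ≤ Var(f) · ∫ g²`, `Var(f) = ∫ f² − (∫ f)²`. [folklore] -/
theorem sq_integral_mul_le_var (β : ℝ) (f g : GaugeConfig d M G → ℝ) (hf : Continuous f) (hg : Continuous g)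
    (hg0 : ∫ U, g U ∂(wilsonMeasure (d := d) (L := M) r.ρ β) = 0) :
    (∫ U, f U * g U ∂(wilsonMeasure (d := d) (L := M) r.ρ β)) ^ 2 ≤
      ((∫ U, f U ^ 2 ∂(wilsonMeasure (d := d) (L := M) r.ρ β)) -
          (∫ U, f U ∂(wilsonMeasure (d := d) (L := M) r.ρ β)) ^ 2) *
        (∫ U, g U ^ 2 ∂(wilsonMeasure (d := d) (L := M) r.ρ β)) := by
  haveI := isProbabilityMeasure_wilsonMeasure (d := d) (L := M) r.ρ r.continuous β
  set μ := wilsonMeasure (d := d) (L := M) r.ρ β with hμ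
  set m := ∫ U, f U ∂μ with hm
  -- centre `f`
  have hu : Continuous fun U => f U - m := hf.sub continuous_const
  have hcs := sq_integral_mul_le r β (fun U => f U - m) g hu hg
  have i_fg : Integrable (fun U => f U * g U) μ := integrable_of_continuous r β (hf.mul hg)
  have i_g : Integrable g μ := integrable_of_continuous r β hg
  have i_f : Integrable f μ := integrable_of_continuous r β hf
  have i_f2 : Integrable (fun U => f U ^ 2) μ := integrable_of_continuous r β (hf.pow 2)
  have h1 : ∫ U, (f U - m) * g U ∂μ = ∫ U, f U * g U ∂μ := by
    have hsplit : (fun U => (f U - m) * g U) = fun U => f U * g U - m * g U := by funext U; ring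
    rw [hsplit, integral_sub i_fg (i_g.const_mul m), integral_const_mul, hg0, mul_zero, sub_zero]
  have h2 : ∫ U, (f U - m) ^ 2 ∂μ = (∫ U, f U ^ 2 ∂μ) - m ^ 2 := by
    have hsplit : (fun U => (f U - m) ^ 2) = fun U => f U ^ 2 - 2 * m * f U + m ^ 2 := by funext U; ring
    have i_mf : Integrable (fun U => 2 * m * f U) μ := i_f.const_mul _
    have i_a : Integrable (fun U => f U ^ 2 - 2 * m * f U) μ := i_f2.sub i_mf
    rw [hsplit, integral_add i_a (integrable_const _), integral_sub i_f2 i_mf, integral_const_mul, integral_const]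
    simp only [smul_eq_mul, probReal_univ]
    rw [← hm]; ring
  rw [h1, h2] at hcs
  exact hcs

/-! ## §2 The Stein operator of a vector field and the Cramér–Rao / Fisher floor -/

/-- **Stein identity** (one-link Schwinger–Dyson, summed over a finite family of directions): for directions
`(eᵢ, kᵢ)` (`kᵢ` multiplicative), a continuous observable `f` with shift-derivatives `f'ᵢ`, continuous `Vᵢ` with
shift-derivatives `V'ᵢ` (along direction `i`) and continuous action derivatives `S'ᵢ`,
`∫ f · Σᵢ (V'ᵢ − β Vᵢ S'ᵢ) dμ_β = − Σᵢ ∫ f'ᵢ Vᵢ dμ_β`. [folklore] -/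
theorem stein_identity (β : ℝ) {ι : Type} [Fintype ι] (e : ι → Edge d M) (k : ι → ℝ → G)
    (hk : ∀ i s t, k i (s + t) = k i s * k i t)
    (f : GaugeConfig d M G → ℝ) (f' V V' S' : ι → GaugeConfig d M G → ℝ)
    (hf : Continuous f) (hf' : ∀ i, Continuous (f' i)) (hV : ∀ i, Continuous (V i))
    (hV' : ∀ i, Continuous (V' i)) (hS' : ∀ i, Continuous (S' i))
    (hdf : ∀ i U, HasDerivAt (fun t => f (Function.update U (e i) (k i t * U (e i)))) (f' i U) 0)
    (hdV : ∀ i U, HasDerivAt (fun t => V i (Function.update U (e i) (k i t * U (e i)))) (V' i U) 0)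
    (hdS : ∀ i U, HasDerivAt (fun t => wilsonAction (d := d) (L := M) r.ρ
      (Function.update U (e i) (k i t * U (e i)))) (S' i U) 0) :
    ∫ U, f U * (∑ i, (V' i U - β * (V i U * S' i U))) ∂(wilsonMeasure (d := d) (L := M) r.ρ β) =
      -∑ i, ∫ U, f' i U * V i U ∂(wilsonMeasure (d := d) (L := M) r.ρ β) := by
  set μ := wilsonMeasure (d := d) (L := M) r.ρ β with hμ
  -- per direction: SD for the observable `f · Vᵢ`
  have hone : ∀ i, ∫ U, f U * (V' i U - β * (V i U * S' i U)) ∂μ = -∫ U, f' i U * V i U ∂μ := by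
    intro i
    have hprod : ∀ U, HasDerivAt (fun t => f (Function.update U (e i) (k i t * U (e i))) *
        V i (Function.update U (e i) (k i t * U (e i)))) (f' i U * V i U + f U * V' i U) 0 := by
      intro U
      have h := (hdf i U).mul (hdV i U)
      simp only [oneParam_zero (hk i), one_mul, Function.update_eq_self] at h
      exact h
    have hsd := integral_shiftDeriv_eq_wilson r β (e i) (hk i) (fun U => f U * V i U)
      (fun U => f' i U * V i U + f U * V' i U) (hf.mul (hV i)) (((hf' i).mul (hV i)).add (hf.mul (hV' i)))
      hprod (S' i) (hS' i) (hdS i)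
    have i1 : Integrable (fun U => f' i U * V i U) μ := integrable_of_continuous r β ((hf' i).mul (hV i))
    have i2 : Integrable (fun U => f U * V' i U) μ := integrable_of_continuous r β (hf.mul (hV' i))
    have i3 : Integrable (fun U => f U * (β * (V i U * S' i U))) μ :=
      integrable_of_continuous r β (hf.mul (continuous_const.mul ((hV i).mul (hS' i))))
    rw [integral_add i1 i2] at hsd
    have hsplit : (fun U => f U * (V' i U - β * (V i U * S' i U))) =
        fun U => f U * V' i U - f U * (β * (V i U * S' i U)) := by funext U; ring
    rw [hsplit, integral_sub i2 i3]
    have h3 : ∫ U, f U * (β * (V i U * S' i U)) ∂μ = β * ∫ U, f U * V i U * S' i U ∂μ := by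
      rw [← integral_const_mul]
      refine integral_congr_ae (ae_of_all _ fun U => ?_)
      ring
    rw [h3]
    linarith
  -- sum over directions
  have hsum : (fun U => f U * ∑ i, (V' i U - β * (V i U * S' i U))) =
      fun U => ∑ i, f U * (V' i U - β * (V i U * S' i U)) := by
    funext U; rw [Finset.mul_sum]
  rw [hsum, integral_finsetSum _ fun i _ => ?_]
  · rw [← Finset.sum_neg_distrib]
    exact Finset.sum_congr rfl fun i _ => hone i
  · exact integrable_of_continuous r β (hf.mul ((hV' i).sub (continuous_const.mul ((hV i).mul (hS' i)))))

/-- The Stein operator has mean zero: `∫ Σᵢ (V'ᵢ − β Vᵢ S'ᵢ) dμ_β = 0` (`stein_identity` with `f ≡ 1`). [folklore] -/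
theorem stein_mean_zero (β : ℝ) {ι : Type} [Fintype ι] (e : ι → Edge d M) (k : ι → ℝ → G)
    (hk : ∀ i s t, k i (s + t) = k i s * k i t) (V V' S' : ι → GaugeConfig d M G → ℝ)
    (hV : ∀ i, Continuous (V i)) (hV' : ∀ i, Continuous (V' i)) (hS' : ∀ i, Continuous (S' i))
    (hdV : ∀ i U, HasDerivAt (fun t => V i (Function.update U (e i) (k i t * U (e i)))) (V' i U) 0)
    (hdS : ∀ i U, HasDerivAt (fun t => wilsonAction (d := d) (L := M) r.ρ
      (Function.update U (e i) (k i t * U (e i)))) (S' i U) 0) :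
    ∫ U, (∑ i, (V' i U - β * (V i U * S' i U))) ∂(wilsonMeasure (d := d) (L := M) r.ρ β) = 0 := by
  have h := stein_identity r β e k hk (fun _ => (1 : ℝ)) (fun _ _ => 0) V V' S' continuous_const
    (fun _ => continuous_const) hV hV' hS' (fun i U => by simpa using hasDerivAt_const (0 : ℝ) (1 : ℝ)) hdV hdS
  simpa using h

/-- **The Cramér–Rao / Fisher floor on the torus.**  With the data of `stein_identity`:
`(Σᵢ ∫ f'ᵢ Vᵢ dμ_β)² ≤ (∫ f² − (∫ f)²) · ∫ (Σᵢ (V'ᵢ − β Vᵢ S'ᵢ))² dμ_β`.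
Taking `Vᵢ = f'ᵢ` (when `f` is twice shift-differentiable) the numerator is the ONE-POINT expectation of the
non-negative density `|∇f|² = Σᵢ (f'ᵢ)²`. [folklore] -/
theorem fisher_floor (β : ℝ) {ι : Type} [Fintype ι] (e : ι → Edge d M) (k : ι → ℝ → G)
    (hk : ∀ i s t, k i (s + t) = k i s * k i t)
    (f : GaugeConfig d M G → ℝ) (f' V V' S' : ι → GaugeConfig d M G → ℝ)
    (hf : Continuous f) (hf' : ∀ i, Continuous (f' i)) (hV : ∀ i, Continuous (V i))
    (hV' : ∀ i, Continuous (V' i)) (hS' : ∀ i, Continuous (S' i))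
    (hdf : ∀ i U, HasDerivAt (fun t => f (Function.update U (e i) (k i t * U (e i)))) (f' i U) 0)
    (hdV : ∀ i U, HasDerivAt (fun t => V i (Function.update U (e i) (k i t * U (e i)))) (V' i U) 0)
    (hdS : ∀ i U, HasDerivAt (fun t => wilsonAction (d := d) (L := M) r.ρ
      (Function.update U (e i) (k i t * U (e i)))) (S' i U) 0) :
    (∑ i, ∫ U, f' i U * V i U ∂(wilsonMeasure (d := d) (L := M) r.ρ β)) ^ 2 ≤
      ((∫ U, f U ^ 2 ∂(wilsonMeasure (d := d) (L := M) r.ρ β)) -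
          (∫ U, f U ∂(wilsonMeasure (d := d) (L := M) r.ρ β)) ^ 2) *
        ∫ U, (∑ i, (V' i U - β * (V i U * S' i U))) ^ 2 ∂(wilsonMeasure (d := d) (L := M) r.ρ β) := by
  set 𝒪 : GaugeConfig d M G → ℝ := fun U => ∑ i, (V' i U - β * (V i U * S' i U)) with h𝒪
  have h𝒪c : Continuous 𝒪 :=
    continuous_finsetSum _ fun i _ => (hV' i).sub (continuous_const.mul ((hV i).mul (hS' i)))
  have hid := stein_identity r β e k hk f f' V V' S' hf hf' hV hV' hS' hdf hdV hdS
  have h0 := stein_mean_zero r β e k hk V V' S' hV hV' hS' hdV hdS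
  have hcs := sq_integral_mul_le_var r β f 𝒪 hf h𝒪c h0
  have hsq : (∑ i, ∫ U, f' i U * V i U ∂(wilsonMeasure (d := d) (L := M) r.ρ β)) ^ 2 =
      (∫ U, f U * 𝒪 U ∂(wilsonMeasure (d := d) (L := M) r.ρ β)) ^ 2 := by
    rw [show (fun U => f U * 𝒪 U) = fun U => f U * ∑ i, (V' i U - β * (V i U * S' i U)) from rfl, hid, neg_sq]
  rw [hsq]
  exact hcs

end Torus

/-! ## §3 Time-zero shell functionals are `Θ`-invariant: the mirror covariance is a variance -/

section TimeZero

variable {G : Type} [Group G]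

/-- A time-0 SPATIAL edge of `ℤ⁴` is fixed by the edge reflection. [folklore] -/
theorem reflectEdge_eq_self_of_timeZero (e : Literature.MathematicalPhysics.QuantumLattice.ZdEdge 4) (h0 : e.1 0 = 0) (hi : e.2 ≠ 0) : reflectEdge e = e := by
  unfold reflectEdge
  rw [if_neg hi]
  have hs : siteReflect e.1 = e.1 := by
    unfold siteReflect
    rw [h0, neg_zero, ← h0, Function.update_eq_self]
  rw [hs]

/-- **A cylinder functional of time-0 spatial links is `Θ`-invariant**: `𝒢 (cfgReflect V) = 𝒢 V`. [folklore] -/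
theorem apply_cfgReflect_of_timeZero {α : Type*} (𝒢 : LGConfig 4 G → α) (S : Finset (Literature.MathematicalPhysics.QuantumLattice.ZdEdge 4))
    (h𝒢 : IsCylinder 𝒢 S) (hS : ∀ e ∈ S, e.1 0 = 0 ∧ e.2 ≠ 0) (V : LGConfig 4 G) :
    𝒢 (cfgReflect V) = 𝒢 V := by
  refine h𝒢 (fun e he => ?_)
  obtain ⟨h0, hi⟩ := hS e he
  show cfgReflect V e = V e
  unfold cfgReflect
  rw [if_neg hi, reflectEdge_eq_self_of_timeZero e h0 hi]

variable (G) [TopologicalSpace G] [IsTopologicalGroup G] [CompactSpace G] [MeasurableSpace G] [BorelSpace G]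
  (r : LatticeRep G)

/-- **For a `Θ`-invariant functional the Markov–mirror covariance is the torus variance**:
`E_T[𝒢∘Θ · 𝒢] − E_T[𝒢∘Θ] E_T[𝒢] = E_T[𝒢²] − E_T[𝒢]²`. [folklore] -/
theorem mirrorCov_eq_var_of_invariant (β : ℝ) (L : ℕ) (𝒢 : LGConfig 4 G → ℝ)
    (hΘ : ∀ V, 𝒢 (cfgReflect V) = 𝒢 V) :
    torusE G r β L (fun V => 𝒢 (cfgReflect V) * 𝒢 V) - torusE G r β L (fun V => 𝒢 (cfgReflect V)) * torusE G r β L 𝒢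
      = torusE G r β L (fun V => 𝒢 V ^ 2) - (torusE G r β L 𝒢) ^ 2 := by
  have h1 : (fun V => 𝒢 (cfgReflect V) * 𝒢 V) = fun V => 𝒢 V ^ 2 := by funext V; rw [hΘ, sq]
  have h2 : (fun V => 𝒢 (cfgReflect V)) = 𝒢 := by funext V; rw [hΘ]
  rw [h1, h2, sq (torusE G r β L 𝒢)]

end TimeZero

/-! ## §4 Transfer: `SF` from a gradient-overlap floor and a score ceiling -/

section Transfer

variable (G : Type) [Group G] [TopologicalSpace G] [IsTopologicalGroup G] [CompactSpace G]
  [MeasurableSpace G] [BorelSpace G] (r : LatticeRep G)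

/-- **`fisher_floor` on the periodic lift**: for a continuous `𝒢 : LGConfig 4 G → ℝ` and Stein data for
`f := 𝒢 ∘ torusLift (2L+1)` on the torus of side `2L+1`,
`(Σᵢ ∫ f'ᵢ Vᵢ)² ≤ (E_T[𝒢²] − E_T[𝒢]²) · ∫ 𝒪_V²`. [folklore] -/
theorem fisher_floor_lift (β : ℝ) (L : ℕ) (𝒢 : LGConfig 4 G → ℝ) (h𝒢 : Continuous 𝒢)
    {ι : Type} [Fintype ι] (e : ι → Edge 4 (2 * L + 1)) (k : ι → ℝ → G)
    (hk : ∀ i s t, k i (s + t) = k i s * k i t)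
    (f' V V' S' : ι → GaugeConfig 4 (2 * L + 1) G → ℝ)
    (hf' : ∀ i, Continuous (f' i)) (hV : ∀ i, Continuous (V i))
    (hV' : ∀ i, Continuous (V' i)) (hS' : ∀ i, Continuous (S' i))
    (hdf : ∀ i U, HasDerivAt (fun t => 𝒢 (torusLift (2 * L + 1) (Function.update U (e i) (k i t * U (e i)))))
      (f' i U) 0)
    (hdV : ∀ i U, HasDerivAt (fun t => V i (Function.update U (e i) (k i t * U (e i)))) (V' i U) 0)
    (hdS : ∀ i U, HasDerivAt (fun t => wilsonAction (d := 4) (L := 2 * L + 1) r.ρ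
      (Function.update U (e i) (k i t * U (e i)))) (S' i U) 0) :
    haveI : NeZero (2 * L + 1) := ⟨by omega⟩
    (∑ i, ∫ U, f' i U * V i U ∂(wilsonMeasure (d := 4) (L := 2 * L + 1) r.ρ β)) ^ 2 ≤
      (torusE G r β L (fun V => 𝒢 V ^ 2) - (torusE G r β L 𝒢) ^ 2) *
        ∫ U, (∑ i, (V' i U - β * (V i U * S' i U))) ^ 2 ∂(wilsonMeasure (d := 4) (L := 2 * L + 1) r.ρ β) := by
  haveI : NeZero (2 * L + 1) := ⟨by omega⟩
  have h := fisher_floor r β e k hk (fun U => 𝒢 (torusLift (2 * L + 1) U)) f' V V' S'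
    (h𝒢.comp (continuous_torusLift (2 * L + 1))) hf' hV hV' hS' hdf hdV hdS
  simpa [torusE] using h

/-- **TRANSFER `SF ⇐ GF ∧ SC`.**  Let the shell functionals `𝒢 β` be `Θ`-invariant for `β ≥ β₅` (e.g. cylinder
functionals of time-0 spatial links, `apply_cfgReflect_of_timeZero`).  Suppose that for every `β ≥ β₅` and every
torus with `Λ₅ ≤ a(β)·L` there are reals `N, D` with `0 ≤ D` and the FISHER relation `N² ≤ Var_T(𝒢 β) · D` (supplied
by `fisher_floor_lift`: `N = Σᵢ E_T[Vᵢ ∂ᵢ𝒢]`, `D = E_T[𝒪_V²] ≥ 0`), a GRADIENT-OVERLAP FLOOR `φ(β) ≤ |N|` (GF) and a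
SCORE CEILING `D ≤ M(β)` (SC), at levels with `0 < φ(β)` and `4ε·M(β) ≤ φ(β)²` (scale-covariant: at tree level
`N ≍ β·Var`, `M ≍ β²·Var`).  Then the hypothesis `hSF` of `Cruxes.NT.MarkovMirror.Q2_floor_of_mirrorPackage` holds with
this `ε`: `4ε ≤ Cov_T(𝒢 β ∘ Θ, 𝒢 β)` on all those tori. [folklore] -/
theorem sf_of_gradOverlapFloor_of_scoreCeiling (a : ℝ → ℝ) (β₅ Λ₅ ε : ℝ) (hε : 0 < ε) (φ M : ℝ → ℝ)
    (𝒢 : ℝ → LGConfig 4 G → ℝ) (hΘ : ∀ β, β₅ ≤ β → ∀ V, 𝒢 β (cfgReflect V) = 𝒢 β V)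
    (hFisher : ∀ β, β₅ ≤ β → ∀ L : ℕ, Λ₅ ≤ a β * L → ∃ N D : ℝ, 0 ≤ D ∧
      N ^ 2 ≤ (torusE G r β L (fun V => 𝒢 β V ^ 2) - (torusE G r β L (𝒢 β)) ^ 2) * D ∧ φ β ≤ |N| ∧ D ≤ M β)
    (hratio : ∀ β, β₅ ≤ β → 0 < φ β ∧ 4 * ε * M β ≤ φ β ^ 2) :
    ∀ β, β₅ ≤ β → ∀ L : ℕ, Λ₅ ≤ a β * L →
      4 * ε ≤ torusE G r β L (fun V => 𝒢 β (cfgReflect V) * 𝒢 β V) -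
        torusE G r β L (fun V => 𝒢 β (cfgReflect V)) * torusE G r β L (𝒢 β) := by
  intro β hβ L hL
  rw [mirrorCov_eq_var_of_invariant G r β L (𝒢 β) (hΘ β hβ)]
  obtain ⟨N, D, hD0, hND, hN, hDM⟩ := hFisher β hβ L hL
  obtain ⟨hφ, hr⟩ := hratio β hβ
  set Var := torusE G r β L (fun V => 𝒢 β V ^ 2) - (torusE G r β L (𝒢 β)) ^ 2 with hVar
  have hφN : φ β ^ 2 ≤ N ^ 2 := by
    rw [← sq_abs N]; nlinarith [hN, hφ.le, abs_nonneg N]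
  have hN2 : 0 < N ^ 2 := lt_of_lt_of_le (by positivity) hφN
  -- `D > 0`: otherwise `N² ≤ Var·0 = 0`
  have hDpos : 0 < D := by
    rcases lt_or_eq_of_le hD0 with h | h
    · exact h
    · rw [← h, mul_zero] at hND; linarith
  -- chain `4ε·D ≤ 4ε·M ≤ φ² ≤ N² ≤ Var·D`
  have h3 : 4 * ε * D ≤ 4 * ε * M β := mul_le_mul_of_nonneg_left hDM (by positivity)
  have h1 : 4 * ε * D ≤ Var * D := ((h3.trans hr).trans hφN).trans hND
  nlinarith [h1, hDpos]

end Transfer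

/-! ## §5 Composition with the RP localiser: a Θ′-invariant localiser turns (LMF) into a variance floor -/

section Invariant

open Summit.QuantumFields.YangMills.Cruxes.OSLegsFromFemtoAndGap.DlrCollarTransfer
open Summit.QuantumFields.YangMills.Cruxes.NT.MirrorSplit (torus_mirror_floor_of_posHalf)

variable (G : Type) [Group G] [TopologicalSpace G] [IsTopologicalGroup G] [CompactSpace G]
  [MeasurableSpace G] [BorelSpace G] (r : LatticeRep G)

/-- **Mirror floor from a Θ′-INVARIANT positive-half localiser.**  On the torus `2L+1` (`L ≥ 1`, `β ≥ 0`), `W` a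
bounded continuous cylinder observable with links at times in `[0, L−1]`, `h` ANY bounded measurable functional of
the closed positive half which is INVARIANT under the site reflection (`h(Θ′U) = h(U)`; e.g. a functional of the time-0
spatial links) and centred on `W`: `MF = Cov_T(W∘Θ₀, W) ≥ Var_T(h) − 2·|Cov_T(h, W∘lift − h)|` — the (LMF) slot is a
plain VARIANCE, for which §2's Cramér–Rao / Stein floor is available. [cite: OsterwalderSeiler1978, §2] -/
theorem torus_mirror_floor_of_invariant_localiser {β : ℝ} (hβ : 0 ≤ β) {L : ℕ} (hL : 1 ≤ L)
    {W : LGConfig 4 G → ℝ} (hWc : Continuous W) {MW : ℝ} (hMW : ∀ U, |W U| ≤ MW)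
    {SW : Finset (Literature.MathematicalPhysics.QuantumLattice.ZdEdge 4)} (hWS : IsCylinder W SW)
    (hSW : ∀ e ∈ SW, 0 ≤ e.1 0 ∧ e.1 0 + 1 ≤ (L : ℤ))
    {h : GaugeConfig 4 (2 * L + 1) G → ℝ} (hh : Measurable h) {K : ℝ} (hK : ∀ U, |h U| ≤ K)
    (hdep : DependsOn h {e : Edge 4 (2 * L + 1) | (e.1 0).val ≤ L ∧ ((e.1.shift e.2) 0).val ≤ L})
    (hinv : ∀ U : GaugeConfig 4 (2 * L + 1) G, h U.negReflect = h U)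
    (hcent : ∫ U, h U ∂(wilsonMeasure (d := 4) (L := 2 * L + 1) r.ρ β) = torusE G r β L W) :
    ((∫ U, h U * h U ∂(wilsonMeasure (d := 4) (L := 2 * L + 1) r.ρ β)) -
        (∫ U, h U ∂(wilsonMeasure (d := 4) (L := 2 * L + 1) r.ρ β)) *
          (∫ U, h U ∂(wilsonMeasure (d := 4) (L := 2 * L + 1) r.ρ β))) -
        2 * |(∫ U, h U * (W (torusLift (2 * L + 1) U) - h U)
              ∂(wilsonMeasure (d := 4) (L := 2 * L + 1) r.ρ β)) -
            (∫ U, h U ∂(wilsonMeasure (d := 4) (L := 2 * L + 1) r.ρ β)) *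
              (∫ U, (W (torusLift (2 * L + 1) U) - h U) ∂(wilsonMeasure (d := 4) (L := 2 * L + 1) r.ρ β))| ≤
      torusE G r β L (fun V => W (cfgReflect V) * W V) -
        torusE G r β L (fun V => W (cfgReflect V)) * torusE G r β L W := by
  have key := torus_mirror_floor_of_posHalf G r hβ hL hWc hMW hWS hSW hh hK hdep hcent
  simp only [hinv] at key
  exact key

end Invariant

end Summit.QuantumFields.YangMills.Cruxes.NT.FisherFloor

end
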